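/-
Copyright (c) 2026 the pub-hodgecm-mathlib formalisation cell (harness21).  Prover seat hodgecm-mathlib-K2E3-p12 (g6): Track B «K2-LIT», ENGINE E1 (on loan
per chair word «β → E1»), h413 = stmt-HodgeConjecture-24833; campaign «EIS-WHITTAKER-2» of the dealer K2E1-plan (g4), rung W3 (deal 2026-09-04T07:19:01Z), FILE 3:
the generic adelic engine of ★ FILE 1 `K2E1AdelicFourierCoeffEulerProduct` at an ADELIC frequency `η ∈ 𝔸_K` (dealer 07:39:43Z «ADELIC frequency η» + 07:28:09Z (ii) «name `S₀`»).
-/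
import Summits.HodgeConjecture.HodgeConjecture.Theorems.K2E1AdelicFourierCoeffEulerProduct          -- ★ p858348 FILE 1 (this seat): split, finite Euler product, archimedean product (rational `ξ`)
import HarnessLib

/-!
# K2·E1 — `K2E1AdelicFourierCoeffEulerProductAdelic` («EIS-WHITTAKER-2», rung W3, FILE 3): THE TRANSFORM `η ↦ ∫ Φ(x)·ψ(ηx) dμ(x)` OF A PURE TENSOR AT AN ADELIC FREQUENCY
# `η ∈ 𝔸_K` SPLITS AND IS AN EULER PRODUCT — `(∫ Φ_∞·𝐞(−Tr(ιη_∞·s)) ds)·(μ_f(𝒪̂)·∏'_v ν_v(𝒪_v)⁻¹∫ g_v(t)·ψ_v(η_v t) dν_v)`, exceptional finset `S_g ∪ S(η_f)`, `S(η_f) = {v : η_v ∉ 𝒪_v}` NAMED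

Track B ∕ K2-LIT, crux h413 = `stmt-HodgeConjecture-24833`, route of record `HCCMUnconditional`; cell `hodgecm-mathlib`, squad K2, ENGINE E1, campaign «EIS-WHITTAKER-2».  Dealer K2E1-plan (g4)
07:39:43Z: «ADELIC frequency `η` (W3-cov ★ p858333 delivers `ξα⁻¹`) + `S₀(η)` named»; conventions memo of record `K2/K2E1b-plan/g5/CONVENTIONS-W3W4-EisWhittaker2.K2E1b-plan-g5.md` §0, §3
(«W3-cov states `Φ̂_1` as the adelic-argument transform `η ↦ ∫ Φ_1(u)·ψ(ηu) dμ(u)`, `η ∈ 𝔸_F` — W4's currency `W : ℂ → 𝔸_K → ℂ`; `adeleFourierCoeff μ Φ ξ` is its value at `η = (ξ)_𝔸` by `rfl`»).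
THEOREMS ONLY (no `def`, no instance, no notation, no named-fact hypothesis, no `sorry`; default heartbeats); lane `--supports stmt-HodgeConjecture-24833 --as helper` (count-neutral, closes
no socket).  GENERIC number field `K`; the archimedean product for `K` totally real.  Separate file by the 400-line law (★ FILE 1 is 319 l.).

THE MATHEMATICS [TateThesis1967 §3.3, §4.1–4.2; Garrett2018 §1.9–§1.10; Bump1997 §3.7] — word for word ★ FILE 1 with the rational frequency `(ξ)_𝔸` replaced by an adele `η = (η_∞, η_f)`:
* **`adeleAddChar_adele_mul_eq_fourierChar_mul`**: `ψ(ηx) = 𝐞(−Tr(ι η_∞·ι x_∞))·ψ_f(η_f x_f)` (★ `adeleAddChar_eq_mul`); `ringEquiv_mixedSpace_algebraMap_fst_and_snd`: at `η = (ξ)_𝔸`, `ι η_∞ = mixedEmbedding K ξ`,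
  `η_f = (ξ)_{𝔸_f}` (consistency with ★ FILE 1).
* **`integral_mul_adeleAddChar_map_split_eq_mul`**: for `μ = σ_*(μ_E ⊗ μ_f)` (`σ` ANY map with components `(ι⁻¹s, b)`) and ANY `Φ_∞`, `Φ_f`:
  `∫ Φ_∞(ι x_∞)·Φ_f(x_f)·ψ(ηx) dμ = (∫ Φ_∞(s)·𝐞(−Tr(ιη_∞·s)) dμ_E)·(∫ Φ_f(b)·ψ_f(η_f b) dμ_f)` (Mathlib `integral_prod_mul`; no integrability hypothesis).
* **`coe_finiteAdeleAddChar_mul_eq_finprod'`**: `ψ_f(η_f b) = ∏ᶠ_v ψ_v(η_v·b_v)`; **`finite_setOf_apply_not_mem_integers`** ∕ **`mem_toFinset_apply_not_mem_integers_iff`**: the NAMED finset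
  `S(η_f) := (finite_setOf_apply_not_mem_integers K η_f).toFinset`, `v ∈ S(η_f) ↔ η_v ∉ 𝒪_v`; **`localFactor_mul_adeleAddCharAt_eq_one_off`**: off `S_g ∪ S(η_f)` the local factor
  `g_v·ψ_v(η_v ·)` is `1` on `𝒪_v` (`ψ_v|𝒪_v = 1` at EVERY `v` ★ — no conductor letter).
* **`hasProd_localCoeff_of_integrable'`**: `HasProd (v ↦ ν_v(𝒪_v)⁻¹·∫ g_v(t)·ψ_v(η_v t) dν_v) (μ(𝒪̂)⁻¹·∫ (∏ᶠ_v g_v(b_v))·ψ_f(η_f b) dμ)` for continuous `g_v`, `= 1` on `𝒪_v` off `S_g`, `∏ᶠ g_v ∈ L¹`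
  (★ `AdelicProductIntegralOne` with the exceptional finset `S_g ∪ S(η_f)`).
* (`K` totally real) **`mixedTrace_mul_of_isTotallyReal`**, **`integral_prod_mul_fourierChar_eq_prod_of_equiv'`**: `∫ (∏_i φ_i(s_{e i}))·𝐞(−Tr(a·s)) ds = ∏_i ∫_ℝ φ_i(x)·e^{−2πi·a_{e i}·x} dx` for an
  ARCHIMEDEAN frequency `a ∈ K ⊗ ℝ` and any bijection `e : ι ≃ {w ∣ ∞}` — each factor is the kernel of ★ W2-arch `integral_onePlusSqPow_mul_phase_eq` :144 at the real frequency `a_{e i}`.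
HONEST LABEL: HC_CM is proved only modulo the 7 printed citations (2 remaining named inputs: hLiu418 = `stmt-HodgeConjecture-24832`, h413 = `stmt-HodgeConjecture-24833`) until rung 0
closes; this file asserts no named fact and closes no socket; count-neutral.

## References
* [TateThesis1967] J. Tate, *Fourier analysis in number fields and Hecke's zeta-functions*, in Cassels–Fröhlich (1967), Ch. XV: Lemma 3.2.1, Thm 3.3.1, §4.1–§4.2.
* [Garrett2018] P. Garrett, *Modern Analysis of Automorphic Forms by Example* 1 (2018), §1.9–§1.10.
* [Bump1997] D. Bump, *Automorphic Forms and Representations* (1997), §1.6 (1.26), §3.7.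
-/

set_option autoImplicit false
set_option linter.dupNamespace false -- the mandated namespace repeats `HodgeConjecture.HodgeConjecture`

noncomputable section

open MeasureTheory Measure NumberField NumberField.InfinitePlace NumberField.mixedEmbedding IsDedekindDomain Set Filter Topology
open scoped ENNReal NNReal Real FourierTransform Classical
open Literature.NumberTheory.Automorphic
open Summit.HodgeConjecture.HodgeConjecture.Cruxes.H413
open Summit.HodgeConjecture.HodgeConjecture.Cruxes.H413.K2E1AdelicFourierCoeffEulerProduct

namespace Summit.HodgeConjecture.HodgeConjecture.Cruxes.H413.K2E1AdelicFourierCoeffEulerProductAdelic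

/-! ## ADELIC frequencies `η ∈ 𝔸_K` — the same splitting, Euler product and archimedean product for `∫ Φ(x)·ψ(ηx) dμ(x)`
(W3-cov ★ `K2E1WhittakerCoefficientCovarianceU2.adeleFourierCoeff_bigCellLine_covariance` moves every `g` to `g = 1` at the DILATED ADELIC frequency `η = ξα⁻¹`, so W4∕W5 consume the
Euler product at `η ∈ 𝔸_K`, not only at `ξ ∈ K`; `adeleFourierCoeff μ Φ ξ` is the value at `η = (ξ)_𝔸` by `rfl`), and the NAMED exceptional finset `S(η_f) = {v : η_v ∉ 𝒪_v}` (dealer K2E1-plan (g4)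
07:28:09Z (ii): W4's `C_f`-support and W5's `P_ξ` index over `S_g ∪ S(η_f)`). -/

section Adelic

variable (K : Type) [Field K] [NumberField K]

/-- **Tate's character at an ADELIC frequency**: `ψ(ηx) = 𝐞(−Tr(ι η_∞ · ι x_∞))·ψ_f(η_f x_f)` for `η, x ∈ 𝔸_K` (★ `adeleAddChar_eq_mul`, ★ `adeleAddChar_infiniteAdeleInl`, ★ `mixedTrace_ringEquiv_mixedSpace`).
[cite: TateThesis1967, §4.1] -/
theorem adeleAddChar_adele_mul_eq_fourierChar_mul (η x : AdeleRing (𝓞 K) K) :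
    (adeleAddChar K (η * x) : ℂ) =
      (𝐞 (-(mixedTrace K (InfiniteAdeleRing.ringEquiv_mixedSpace K η.1 * InfiniteAdeleRing.ringEquiv_mixedSpace K x.1))) : ℂ) * (finiteAdeleAddChar K (η.2 * x.2) : ℂ) := by
  have h1 : (η * x).1 = η.1 * x.1 := rfl
  have h2 : (η * x).2 = η.2 * x.2 := rfl
  rw [adeleAddChar_eq_mul, Circle.coe_mul, adeleAddChar_infiniteAdeleInl, ← mixedTrace_ringEquiv_mixedSpace, h1, h2, map_mul]

/-- Consistency with ED. 1: at a rational frequency `η = (ξ)_𝔸`, `ι η_∞ = mixedEmbedding K ξ` and `η_f = (ξ)_{𝔸_f}` (Mathlib `mixedEmbedding_eq_algebraMap_comp`, ★ `AdeleRing.algebraMap_fst∕snd`). [folklore] -/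
theorem ringEquiv_mixedSpace_algebraMap_fst_and_snd (ξ : K) :
    InfiniteAdeleRing.ringEquiv_mixedSpace K (algebraMap K (AdeleRing (𝓞 K) K) ξ).1 = mixedEmbedding K ξ ∧
      (algebraMap K (AdeleRing (𝓞 K) K) ξ).2 = algebraMap K (FiniteAdeleRing (𝓞 K) K) ξ :=
  ⟨by rw [AdeleRing.algebraMap_fst, ← InfiniteAdeleRing.mixedEmbedding_eq_algebraMap_comp], rfl⟩

/-- **THE TRANSFORM OF A PURE TENSOR AT AN ADELIC FREQUENCY SPLITS**: for `μ = σ_*(μ_E ⊗ μ_f)` and ANY `Φ_∞`, `Φ_f`, `η ∈ 𝔸_K`,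
`∫ Φ_∞(ι x_∞)·Φ_f(x_f)·ψ(ηx) dμ(x) = (∫ Φ_∞(s)·𝐞(−Tr(ι η_∞·s)) dμ_E(s)) · (∫ Φ_f(b)·ψ_f(η_f b) dμ_f(b))` (no integrability hypothesis; W4's currency `W : ℂ → 𝔸_K → ℂ`).
[cite: TateThesis1967, §4.2] [cite: Garrett2018, §1.9] -/
theorem integral_mul_adeleAddChar_map_split_eq_mul [MeasurableSpace (AdeleRing (𝓞 K) K)] [BorelSpace (AdeleRing (𝓞 K) K)] [MeasurableSpace (FiniteAdeleRing (𝓞 K) K)]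
    [BorelSpace (FiniteAdeleRing (𝓞 K) K)] (μE : Measure (mixedSpace K)) [SFinite μE] (μf : Measure (FiniteAdeleRing (𝓞 K) K)) [SFinite μf]
    {σ : mixedSpace K × FiniteAdeleRing (𝓞 K) K → AdeleRing (𝓞 K) K} (hσ : ∀ p, (σ p).1 = (InfiniteAdeleRing.ringEquiv_mixedSpace K).symm p.1 ∧ (σ p).2 = p.2)
    (Φinf : mixedSpace K → ℂ) (Φfin : FiniteAdeleRing (𝓞 K) K → ℂ) (η : AdeleRing (𝓞 K) K) :
    ∫ x, Φinf (InfiniteAdeleRing.ringEquiv_mixedSpace K x.1) * Φfin x.2 * (adeleAddChar K (η * x) : ℂ) ∂((μE.prod μf).map σ) =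
      (∫ s, Φinf s * (𝐞 (-(mixedTrace K (InfiniteAdeleRing.ringEquiv_mixedSpace K η.1 * s))) : ℂ) ∂μE) *
        ∫ b, Φfin b * (finiteAdeleAddChar K (η.2 * b) : ℂ) ∂μf := by
  rw [(measurableEmbedding_split K hσ).integral_map, ← integral_prod_mul]
  refine integral_congr_ae (Eventually.of_forall fun p => ?_)
  dsimp only
  rw [adeleAddChar_adele_mul_eq_fourierChar_mul, (hσ p).1, (hσ p).2, RingEquiv.apply_symm_apply]
  ring

/-- **`ψ_f(η_f b) = ∏_v ψ_v(η_v·b_v)` in `ℂ`** for `η_f, b ∈ 𝔸_{K,f}` (ED. 1 `coe_finiteAdeleAddChar_mul_eq_finprod` is the case `η_f = (ξ)_{𝔸_f}`). [cite: TateThesis1967, §4.1] -/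
theorem coe_finiteAdeleAddChar_mul_eq_finprod' (ηf b : FiniteAdeleRing (𝓞 K) K) :
    (finiteAdeleAddChar K (ηf * b) : ℂ) = ∏ᶠ v : HeightOneSpectrum (𝓞 K), (adeleAddCharAt K v (ηf v * b v) : ℂ) := by
  have hfin := finite_mulSupport_localFactor K (S := ∅) (g := fun v t => adeleAddCharAt K v t) (fun v _ t ht => adeleAddCharAt_eq_one_of_mem K v ht) (ηf * b)
  have h := map_finprod Circle.coeHom hfin
  simp only [Circle.coeHom_apply] at h
  rw [finiteAdeleAddChar_eq_finprod, h]
  exact finprod_congr fun v => rfl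

/-- **THE NAMED EXCEPTIONAL SET `S(η_f) = {v : η_v ∉ 𝒪_v}` IS FINITE** (a finite adele is integral off a finite set); its finset is `(finite_setOf_apply_not_mem_integers K η_f).toFinset`, membership
`Set.Finite.mem_toFinset`.  The Euler products below have exceptional finset `S_g ∪ S(η_f)`. [cite: TateThesis1967, §3.1] -/
theorem finite_setOf_apply_not_mem_integers (ηf : FiniteAdeleRing (𝓞 K) K) : {v : HeightOneSpectrum (𝓞 K) | ηf v ∉ v.adicCompletionIntegers K}.Finite :=
  Filter.eventually_cofinite.1 ηf.2

/-- Membership in the named exceptional finset: `v ∈ S(η_f) ↔ η_v ∉ 𝒪_v`. [folklore] -/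
theorem mem_toFinset_apply_not_mem_integers_iff (ηf : FiniteAdeleRing (𝓞 K) K) (v : HeightOneSpectrum (𝓞 K)) :
    v ∈ (finite_setOf_apply_not_mem_integers K ηf).toFinset ↔ ηf v ∉ v.adicCompletionIntegers K :=
  Set.Finite.mem_toFinset _

/-- Off `S_g ∪ S(η_f)` the local factor `g_v·ψ_v(η_v ·)` is `1` on `𝒪_v` (`ψ_v = 1` on `𝒪_v` at every `v`, ★ `adeleAddCharAt_eq_one_of_mem`). [cite: TateThesis1967, §3.3] -/
theorem localFactor_mul_adeleAddCharAt_eq_one_off {g : ∀ v : HeightOneSpectrum (𝓞 K), v.adicCompletion K → ℂ} {S : Finset (HeightOneSpectrum (𝓞 K))}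
    (hg1 : ∀ v ∉ S, ∀ t ∈ v.adicCompletionIntegers K, g v t = 1) (ηf : FiniteAdeleRing (𝓞 K) K) :
    ∀ v ∉ S ∪ (finite_setOf_apply_not_mem_integers K ηf).toFinset, ∀ t ∈ v.adicCompletionIntegers K, g v t * (adeleAddCharAt K v (ηf v * t) : ℂ) = 1 := by
  intro v hv t ht
  rw [Finset.mem_union, not_or, mem_toFinset_apply_not_mem_integers_iff, not_not] at hv
  rw [hg1 v hv.1 t ht, adeleAddCharAt_eq_one_of_mem K v (mul_mem hv.2 ht), Circle.coe_one, one_mul]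

/-- **THE FINITE PART AT AN ADELIC FREQUENCY IS AN EULER PRODUCT** (the `η_f ∈ 𝔸_{K,f}` twin of `hasProd_localCoeff_of_integrable`): for continuous local factors `g_v`, `= 1` on `𝒪_v` off a
finset `S`, with `∏ᶠ_v g_v(b_v) ∈ L¹(μ)`:  `HasProd (v ↦ ν_v(𝒪_v)⁻¹·∫ g_v(t)·ψ_v(η_v t) dν_v(t)) (μ(𝒪̂)⁻¹·∫ (∏ᶠ_v g_v(b_v))·ψ_f(η_f b) dμ(b))`, exceptional finset `S ∪ S(η_f)`.
[cite: TateThesis1967, Thm 3.3.1] [cite: Bump1997, §3.7] -/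
theorem hasProd_localCoeff_of_integrable' [MeasurableSpace (FiniteAdeleRing (𝓞 K) K)] [BorelSpace (FiniteAdeleRing (𝓞 K) K)]
    [∀ v : HeightOneSpectrum (𝓞 K), MeasurableSpace (v.adicCompletion K)] [∀ v : HeightOneSpectrum (𝓞 K), BorelSpace (v.adicCompletion K)]
    (μ : Measure (FiniteAdeleRing (𝓞 K) K)) [μ.IsAddHaarMeasure]
    (ν : ∀ v : HeightOneSpectrum (𝓞 K), Measure (v.adicCompletion K)) [∀ v, (ν v).IsAddHaarMeasure]
    (g : ∀ v : HeightOneSpectrum (𝓞 K), v.adicCompletion K → ℂ) (S : Finset (HeightOneSpectrum (𝓞 K))) (hcont : ∀ v, Continuous (g v))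
    (hg1 : ∀ v ∉ S, ∀ t ∈ v.adicCompletionIntegers K, g v t = 1) (ηf : FiniteAdeleRing (𝓞 K) K) (hint : Integrable (fun b : FiniteAdeleRing (𝓞 K) K => ∏ᶠ v, g v (b v)) μ) :
    HasProd (fun v : HeightOneSpectrum (𝓞 K) => (ν v (v.adicCompletionIntegers K)).toReal⁻¹ • ∫ t, g v t * (adeleAddCharAt K v (ηf v * t) : ℂ) ∂ν v)
      ((μ {b | ∀ v, b v ∈ v.adicCompletionIntegers K}).toReal⁻¹ • ∫ b, (∏ᶠ v, g v (b v)) * (finiteAdeleAddChar K (ηf * b) : ℂ) ∂μ) := by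
  classical
  have hcont' : ∀ v, Continuous fun t : v.adicCompletion K => g v t * (adeleAddCharAt K v (ηf v * t) : ℂ) := fun v =>
    (hcont v).mul (continuous_subtype_val.comp ((continuous_adeleAddCharAt K v).comp (continuous_const.mul continuous_id)))
  have hpt : ∀ b : FiniteAdeleRing (𝓞 K) K, (∏ᶠ v, g v (b v) * (adeleAddCharAt K v (ηf v * b v) : ℂ)) = (∏ᶠ v, g v (b v)) * (finiteAdeleAddChar K (ηf * b) : ℂ) := by
    intro b
    rw [coe_finiteAdeleAddChar_mul_eq_finprod', finprod_mul_distrib]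
    · exact finite_mulSupport_localFactor K hg1 b
    · exact finite_mulSupport_localFactor K (S := ∅) (g := fun v t => (adeleAddCharAt K v t : ℂ))
        (fun v _ t ht => by rw [adeleAddCharAt_eq_one_of_mem K v ht, Circle.coe_one]) (ηf * b)
  have hint' : Integrable (fun b : FiniteAdeleRing (𝓞 K) K => ∏ᶠ v, g v (b v) * (adeleAddCharAt K v (ηf v * b v) : ℂ)) μ := by
    simp_rw [hpt]
    refine hint.mul_bdd (c := 1) ?_ (Eventually.of_forall fun b => ?_)
    · exact (continuous_subtype_val.comp ((continuous_finiteAdeleAddChar K).comp (continuous_const.mul continuous_id))).aestronglyMeasurable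
    · rw [Circle.norm_coe]
  have h := AdelicProductIntegralOne.hasProd_localIntegral_of_integrable_one K μ ν (fun v t => g v t * (adeleAddCharAt K v (ηf v * t) : ℂ))
    (S ∪ (finite_setOf_apply_not_mem_integers K ηf).toFinset) hcont' (localFactor_mul_adeleAddCharAt_eq_one_off K hg1 ηf) hint'
  simp_rw [hpt] at h
  exact h

/-- Over a TOTALLY REAL `K`: `Tr(a·s) = Σ_w a_w·s_w` for `a, s ∈ K ⊗ ℝ` (the `a ∈ K ⊗ ℝ` twin of `mixedTrace_mixedEmbedding_mul_of_isTotallyReal`). [folklore] -/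
theorem mixedTrace_mul_of_isTotallyReal [IsTotallyReal K] (a s : mixedSpace K) :
    mixedTrace K (a * s) = ∑ w : {w : InfinitePlace K // IsReal w}, a.1 w * s.1 w := by
  haveI : IsEmpty {w : InfinitePlace K // IsComplex w} := ⟨fun w => (not_isReal_iff_isComplex.2 w.2) (IsTotallyReal.isReal w.1)⟩
  simp only [mixedTrace_apply, Finset.univ_eq_empty, Finset.sum_empty, add_zero]
  rfl

/-- **THE ARCHIMEDEAN FACTOR AT AN ARCHIMEDEAN FREQUENCY `a ∈ K ⊗ ℝ`** (`K` totally real, Lebesgue measure, real places re-indexed along `e : ι ≃ {w ∣ ∞}`):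
`∫ (∏_i φ_i(s_{e i}))·𝐞(−Tr(a·s)) ds = ∏_i ∫_ℝ φ_i(x)·e^{−2πi·a_{e i}·x} dx` — each factor the kernel of ★ W2-arch :144 at the real frequency `a_{e i}`. [cite: TateThesis1967, §4.1] [cite: Bump1997, §1.6 (1.26)] -/
theorem integral_prod_mul_fourierChar_eq_prod_of_equiv' [IsTotallyReal K] {ι : Type*} [Fintype ι] (e : ι ≃ {w : InfinitePlace K // IsReal w}) (φ : ι → ℝ → ℂ) (a : mixedSpace K) :
    ∫ s : mixedSpace K, (∏ i, φ i (s.1 (e i))) * (𝐞 (-(mixedTrace K (a * s))) : ℂ) =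
      ∏ i, ∫ x : ℝ, φ i x * Complex.exp (-(2 * π * Complex.I * a.1 (e i) * x)) := by
  haveI : IsEmpty {w : InfinitePlace K // IsComplex w} := ⟨fun w => (not_isReal_iff_isComplex.2 w.2) (IsTotallyReal.isReal w.1)⟩
  -- reduce to `ι = {w ∣ ∞}` through `φ' w := φ (e⁻¹ w)`
  have hre : ∀ s : mixedSpace K, (∏ i, φ i (s.1 (e i))) = ∏ w, φ (e.symm w) (s.1 w) := fun s =>
    Fintype.prod_equiv e _ _ fun i => by rw [Equiv.symm_apply_apply]
  simp_rw [hre]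
  have hF : (fun s : mixedSpace K => (∏ w, φ (e.symm w) (s.1 w)) * (𝐞 (-(mixedTrace K (a * s))) : ℂ)) =
      fun s => (fun x : {w : InfinitePlace K // IsReal w} → ℝ => ∏ w, φ (e.symm w) (x w) * Complex.exp (-(2 * π * Complex.I * a.1 w * x w))) s.1 := by
    funext s
    dsimp only
    rw [mixedTrace_mul_of_isTotallyReal, coe_fourierChar_neg_sum, Finset.prod_mul_distrib]
  have h1 : (volume : Measure ({w : InfinitePlace K // IsComplex w} → ℂ)).real univ = 1 := by
    rw [measureReal_def, volume_pi, Measure.pi_univ, Finset.prod_of_isEmpty, ENNReal.toReal_one]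
  have key := integral_fun_fst (μ := (volume : Measure ({w : InfinitePlace K // IsReal w} → ℝ))) (ν := (volume : Measure ({w : InfinitePlace K // IsComplex w} → ℂ)))
    (fun x : {w : InfinitePlace K // IsReal w} → ℝ => ∏ w, φ (e.symm w) (x w) * Complex.exp (-(2 * π * Complex.I * a.1 w * x w)))
  have key2 := integral_fintype_prod_volume_eq_prod (𝕜 := ℂ)
    (fun (w : {w : InfinitePlace K // IsReal w}) (y : ℝ) => φ (e.symm w) y * Complex.exp (-(2 * π * Complex.I * a.1 w * y)))
  rw [h1, one_smul] at key
  rw [hF, volume_eq_prod]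
  refine (key.trans key2).trans ?_
  exact (Fintype.prod_equiv e _ _ fun i => by rw [Equiv.symm_apply_apply]).symm

end Adelic

end Summit.HodgeConjecture.HodgeConjecture.Cruxes.H413.K2E1AdelicFourierCoeffEulerProductAdelic

end
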